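import Summits.FinalStateConjecture.FinalStateConjecture.Theorems.EIHFluxBalanceInertialRecessionCalculus

/-!
# Route EIHFluxBalance — `InertialRecession`: `Cᵐ` decay of the MODULATED boosted Kerr–Schild term

Helper file for the crux `stmt-FinalStateConjecture-10166`
(`Summit.FinalStateConjecture.FinalStateConjecture.Theses.EIHFluxBalance.InertialRecession`).

The reference bilinear-form field of the crux's modulated ansatz is
`η + Σᵢ (boostedKerrBilin (Λᵢ(x⁰)) (x⁰, ξᵢ(x⁰)) Mᵢ aᵢ x − η)`: each summand is the Kerr–Schild
perturbation `g_{M,a} − η` seen in a frame `Θ(x⁰) = Λ(x⁰)⁻¹` and about a centre `c(x⁰)` that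
both depend on LAB TIME. Every re-charting of the crux (flat chart on hole-following domains, hole
charts) needs the `Cᵐ` size of such a summand far from its centre, where derivatives may fall on
the motion `(Θ, c)` as well as on the point. This file proves the generic decay estimate

  `‖Dᵐ [y ↦ (g_{M,a}(Θ(y⁰)(y − c(y⁰))) − η)(Θ(y⁰)·, Θ(y⁰)·)] (x)‖ ≤ C(M, m, Γ) / d`

(`exists_norm_iteratedFDeriv_ksPert_frame_le`) whenever the frame and centre paths are `Cᵐ` with
`‖Θ^{(k)}(x⁰)‖ ≤ Γ` (`k ≤ m`), `‖c^{(k)}(x⁰)‖ ≤ Γ` (`1 ≤ k ≤ m`), the point is at lab distance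
`‖x − c(x⁰)‖ ≤ d` and rest-frame spatial radius `‖(Θ(x⁰)(x − c(x⁰)))~‖ ≥ d ≥ max 1 (2|a|)`.
The constant does NOT require the motion to converge — only pointwise bounds on `m` derivatives —
which is what the re-charting after painting rigidity / re-modulation supplies.

Proof: SCALING, as in `Kerr.norm_iteratedFDeriv_ksPert_le`. With `ε = 1/d`,
`g_{M,a} − η = εM (g_{1,εa} − η) ∘ (ε ·)` (`Kerr.ksPert_smul`), so the rest-frame factor is
`P = εM · K ∘ f₂` with `K = g_{1,εa} − η` smooth on `{r > 0}` and `f₂(y) = εΘ(y⁰)(y − c(y⁰))`.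
At `x`, `f₂(x)` lies in the compact shell `‖z‖ ≤ Γ`, `‖z~‖ ≥ 1` on which all derivatives of
`K` of order `≤ m` are bounded by `B(m, Γ)` uniformly in `|εa| ≤ 1/2`
(`exists_bound_iteratedFDeriv_ksPert_shell`), while `‖Dʲ f₂(x)‖ ≤ Dʲ` with `D = 2ᵐ Γ (2 + Γ)`
because every factor `‖x − c‖ ≤ d` produced by a derivative falling on `Θ` comes with the factor
`ε = 1/d` (`norm_iteratedFDeriv_scaled_restPosition_le`); Mathlib's Faà di Bruno bound
`norm_iteratedFDerivWithin_comp_le` gives `‖Dᵏ P(x)‖ ≤ ε|M| m! B Dᵐ`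
(`exists_norm_iteratedFDeriv_restFactor_le`). The frame factors `Θ(y⁰)v`, `Θ(y⁰)w` are then
attached to the SCALAR functions `y ↦ P(y)(Θ(y⁰)v)(Θ(y⁰)w)` by two Leibniz bounds
(`norm_iteratedFDerivWithin_clm_apply`), and the operator norm of `Dᵐ` of the form-valued map is
recovered from its scalar evaluations (`norm_iteratedFDeriv_bilinearComp_frame_le`, via
`norm_iteratedFDeriv_le_of_forall_apply₂`) — this detour avoids bilinear maps between spaces
of operators, whose normed instances Lean does not find.
-/

noncomputable section

open Literature.Geometry.Lorentzian Set Filter Function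
open scoped ContDiff Topology

namespace Summit.FinalStateConjecture.FinalStateConjecture.Theorems

/-- Norm of the iterated derivative of a constant multiple, stated for GENERIC normed spaces (so
that the scalar-tower instances are resolved once here and not on concrete operator spaces).
[folklore] -/
theorem norm_iteratedFDerivWithin_const_smul_eq {E' G : Type*} [NormedAddCommGroup E']
    [NormedSpace ℝ E'] [NormedAddCommGroup G] [NormedSpace ℝ G] (a : ℝ) {f : E' → G}
    {s : Set E'} {x : E'} {i : ℕ} (hf : ContDiffWithinAt ℝ i f s x) (hs : UniqueDiffOn ℝ s)
    (hx : x ∈ s) :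
    ‖iteratedFDerivWithin ℝ i (fun y ↦ a • f y) s x‖ = |a| * ‖iteratedFDerivWithin ℝ i f s x‖ := by
  rw [show (fun y ↦ a • f y) = a • f from rfl, iteratedFDerivWithin_const_smul_apply hf hs hx,
    norm_smul, Real.norm_eq_abs]

/-- **Step 1 — derivatives of the scaled rest-frame position `f₂(y) = εΘ(y⁰)(y − c(y⁰))`.** With
`‖Θ⁽ᵏ⁾(x⁰)‖ ≤ Γ` (`k ≤ m`), `‖c⁽ᵏ⁾(x⁰)‖ ≤ Γ` (`1 ≤ k ≤ m`), `Γ ≥ 1`, `0 < ε ≤ 1` and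
`ε‖x − c(x⁰)‖ ≤ 1`: `‖Dʲ f₂(x)‖ ≤ (2ᵐ Γ (2 + Γ))ʲ` for `1 ≤ j ≤ m` (Leibniz for the application
`Θ(y⁰)(V y)` plus `‖Dˡ V‖ ≤ d, 1 + Γ`). [folklore] -/
theorem norm_iteratedFDeriv_scaled_restPosition_le {Θ : ℝ → E4 →L[ℝ] E4} {c : ℝ → E4} {m : ℕ}
    {Γ ε : ℝ} {x : E4} (hΘ : ContDiff ℝ m Θ) (hc : ContDiff ℝ m c)
    (hΘb : ∀ k ≤ m, ‖iteratedDeriv k Θ (x 0)‖ ≤ Γ)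
    (hcb : ∀ k, 1 ≤ k → k ≤ m → ‖iteratedDeriv k c (x 0)‖ ≤ Γ) (hΓ : 1 ≤ Γ) (hε0 : 0 < ε)
    (hε1 : ε ≤ 1) (hεx : ε * ‖x - c (x 0)‖ ≤ 1) {j : ℕ} (hj1 : 1 ≤ j) (hj : j ≤ m) :
    ‖iteratedFDeriv ℝ j (fun y : E4 ↦ ε • Θ (y 0) (y - c (y 0))) x‖ ≤
      (2 ^ m * Γ * (2 + Γ)) ^ j := by
  have hΓ0 : 0 ≤ Γ := zero_le_one.trans hΓ
  set d : ℝ := ‖x - c (x 0)‖ with hd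
  have hproj : ContDiff ℝ m (fun y : E4 ↦ y 0) :=
    (EuclideanSpace.proj (0 : Fin 4) : E4 →L[ℝ] ℝ).contDiff
  have hΘπc : ContDiff ℝ m (fun y : E4 ↦ Θ (y 0)) := hΘ.comp hproj
  have hVc : ContDiff ℝ m (fun y : E4 ↦ y - c (y 0)) := contDiff_id.sub (hc.comp hproj)
  have hφc : ContDiff ℝ m (fun y : E4 ↦ Θ (y 0) (y - c (y 0))) := hΘπc.clm_apply hVc
  have hΘπb : ∀ i ≤ m, ‖iteratedFDeriv ℝ i (fun y : E4 ↦ Θ (y 0)) x‖ ≤ Γ := fun i hi ↦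
    (norm_iteratedFDeriv_comp_time_le hΘ x (by exact_mod_cast hi)).trans (hΘb i hi)
  have hVb : ∀ l ≤ m, ‖iteratedFDeriv ℝ l (fun y : E4 ↦ y - c (y 0)) x‖ ≤ d + 1 + Γ := by
    intro l hl
    rcases Nat.eq_zero_or_pos l with rfl | hl1
    · rw [norm_iteratedFDeriv_zero]
      linarith
    · have h1 := norm_iteratedFDeriv_sub_centre_le hc x hl1 (by exact_mod_cast hl)
      have h2 := hcb l hl1 hl
      have h3 : 0 ≤ d := norm_nonneg _
      linarith
  have hφb : ‖iteratedFDeriv ℝ j (fun y : E4 ↦ Θ (y 0) (y - c (y 0))) x‖ ≤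
      2 ^ j * Γ * (d + 1 + Γ) := by
    have h1 := norm_iteratedFDeriv_clm_apply (f := fun y : E4 ↦ Θ (y 0))
      (g := fun y : E4 ↦ y - c (y 0)) hΘπc hVc x (n := j) (by exact_mod_cast hj)
    refine h1.trans ?_
    exact sum_choose_mul_mul_le hΓ0 (fun i hi ↦ hΘπb i (hi.trans hj)) (fun i ↦ norm_nonneg _)
      fun i hi ↦ hVb i (hi.trans hj)
  have e1 : iteratedFDeriv ℝ j (fun y : E4 ↦ ε • Θ (y 0) (y - c (y 0))) x =
      ε • iteratedFDeriv ℝ j (fun y : E4 ↦ Θ (y 0) (y - c (y 0))) x :=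
    iteratedFDeriv_const_smul_apply' ((hφc.of_le (by exact_mod_cast hj)).contDiffAt)
  rw [e1, norm_smul, Real.norm_eq_abs, abs_of_pos hε0]
  have h2 : (2 : ℝ) ^ j ≤ 2 ^ m := pow_le_pow_right₀ one_le_two hj
  have h3 : ε * (d + 1 + Γ) ≤ 2 + Γ := by nlinarith
  have hD1 : (1 : ℝ) ≤ 2 ^ m * Γ * (2 + Γ) := by
    have h4 : (1 : ℝ) ≤ 2 ^ m := one_le_pow₀ one_le_two
    nlinarith [mul_le_mul h4 hΓ zero_le_one (zero_le_one.trans h4)]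
  calc ε * ‖iteratedFDeriv ℝ j (fun y : E4 ↦ Θ (y 0) (y - c (y 0))) x‖
      ≤ ε * (2 ^ j * Γ * (d + 1 + Γ)) := mul_le_mul_of_nonneg_left hφb hε0.le
    _ = 2 ^ j * Γ * (ε * (d + 1 + Γ)) := by ring
    _ ≤ 2 ^ m * Γ * (2 + Γ) := by gcongr
    _ ≤ (2 ^ m * Γ * (2 + Γ)) ^ j := le_self_pow₀ hD1 (by omega)

-- operator-norm instance paths on form-valued multilinear maps are slow to unify
set_option synthInstance.maxHeartbeats 200000 in
/-- **Step 2 — the rest-frame factor `P(y) = g_{M,a}(Θ(y⁰)(y − c(y⁰))) − η`.** For every order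
`m` and size `Γ ≥ 1` there is `C₁ ≥ 0` with `‖Dᵏ P(x)‖ ≤ |M| C₁ / d` for all `k ≤ m` under the
hypotheses of `exists_norm_iteratedFDeriv_ksPert_frame_le` (scaling `g_{M,a} − η = εM(g_{1,εa} −
η) ∘ (ε·)` with `ε = 1/d`, the compact-shell bound, and Faà di Bruno). Kerr–Schild 1965, §2–§3.
[cite: KerrSchild1965, §3] -/
theorem exists_norm_iteratedFDeriv_restFactor_le (m : ℕ) {Γ : ℝ} (hΓ : 1 ≤ Γ) :
    ∃ C₁ : ℝ, 0 ≤ C₁ ∧ ∀ (M a : ℝ) (Θ : ℝ → E4 →L[ℝ] E4) (c : ℝ → E4) (x : E4) (d : ℝ),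
      ContDiff ℝ m Θ → ContDiff ℝ m c →
      (∀ k ≤ m, ‖iteratedDeriv k Θ (x 0)‖ ≤ Γ) →
      (∀ k, 1 ≤ k → k ≤ m → ‖iteratedDeriv k c (x 0)‖ ≤ Γ) →
      max 1 (2 * |a|) ≤ d → ‖x - c (x 0)‖ ≤ d →
      d ≤ E4.spatialNorm (Θ (x 0) (x - c (x 0))) →
      ∀ k ≤ m, ‖iteratedFDeriv ℝ k
        (fun y ↦ Kerr.bilin M a (Θ (y 0) (y - c (y 0))) - Minkowski.bilin) x‖ ≤ |M| * C₁ / d := by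
  obtain ⟨B, hB0, hB⟩ := exists_bound_iteratedFDeriv_ksPert_shell' m Γ
  have hΓ0 : 0 ≤ Γ := zero_le_one.trans hΓ
  set D : ℝ := 2 ^ m * Γ * (2 + Γ) with hD
  have hD1 : 1 ≤ D := by
    have h2 : (1 : ℝ) ≤ 2 ^ m := one_le_pow₀ one_le_two
    rw [hD]
    nlinarith [mul_le_mul h2 hΓ zero_le_one (zero_le_one.trans h2)]
  refine ⟨(m.factorial : ℝ) * B * D ^ m, by positivity, ?_⟩
  intro M a Θ c x d hΘ hc hΘb hcb hd hxd hsp k hk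
  -- scalars
  have hd1 : 1 ≤ d := (le_max_left _ _).trans hd
  have hd0 : 0 < d := one_pos.trans_le hd1
  have hda : 2 * |a| ≤ d := (le_max_right _ _).trans hd
  set ε : ℝ := d⁻¹ with hε
  have hε0 : 0 < ε := inv_pos.mpr hd0
  have hε1 : ε ≤ 1 := inv_le_one_of_one_le₀ hd1
  have hεd : ε * d = 1 := inv_mul_cancel₀ hd0.ne'
  have hεa : |ε * a| ≤ 1 / 2 := by
    rw [abs_mul, abs_of_pos hε0]
    have h1 : ε * (2 * |a|) ≤ ε * d := mul_le_mul_of_nonneg_left hda hε0.le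
    rw [hεd] at h1
    linarith
  have hεx : ε * ‖x - c (x 0)‖ ≤ 1 := by
    calc ε * ‖x - c (x 0)‖ ≤ ε * d := mul_le_mul_of_nonneg_left hxd hε0.le
      _ = 1 := hεd
  -- the maps
  set f₂ : E4 → E4 := fun y ↦ ε • Θ (y 0) (y - c (y 0)) with hf₂
  set K : E4 → E4 →L[ℝ] E4 →L[ℝ] ℝ := fun z ↦ Kerr.bilin 1 (ε * a) z - Minkowski.bilin with hK
  set O : Set E4 := {z | 0 < Kerr.radius (ε * a) z} with hO
  set s : Set E4 := f₂ ⁻¹' O with hs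
  have hproj : ContDiff ℝ m (fun y : E4 ↦ y 0) :=
    (EuclideanSpace.proj (0 : Fin 4) : E4 →L[ℝ] ℝ).contDiff
  have hf₂c : ContDiff ℝ m f₂ :=
    ((hΘ.comp hproj).clm_apply (contDiff_id.sub (hc.comp hproj))).const_smul ε
  have hOo : IsOpen O := isOpen_lt continuous_const (Kerr.continuous_radius _)
  have hso : IsOpen s := hOo.preimage hf₂c.continuous
  have hKc : ContDiffOn ℝ m K O := fun z hz ↦ (Kerr.contDiffAt_ksPert hz).contDiffWithinAt
  -- the point `x`: size and position of `f₂ x`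
  have hΘ0 : ‖Θ (x 0)‖ ≤ Γ := by simpa using hΘb 0 (Nat.zero_le m)
  have hnf₂x : ‖f₂ x‖ ≤ Γ := by
    change ‖ε • Θ (x 0) (x - c (x 0))‖ ≤ Γ
    rw [norm_smul, Real.norm_eq_abs, abs_of_pos hε0]
    have h1 : ‖Θ (x 0) (x - c (x 0))‖ ≤ Γ * d :=
      (ContinuousLinearMap.le_opNorm _ _).trans (mul_le_mul hΘ0 hxd (norm_nonneg _) hΓ0)
    calc ε * ‖Θ (x 0) (x - c (x 0))‖ ≤ ε * (Γ * d) := mul_le_mul_of_nonneg_left h1 hε0.le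
      _ = Γ * (ε * d) := by ring
      _ = Γ := by rw [hεd, mul_one]
  have hsp1 : 1 ≤ E4.spatialNorm (f₂ x) := by
    change 1 ≤ ‖E4.spatial (ε • Θ (x 0) (x - c (x 0)))‖
    rw [map_smul, norm_smul, Real.norm_eq_abs, abs_of_pos hε0]
    calc (1 : ℝ) = ε * d := hεd.symm
      _ ≤ ε * ‖E4.spatial (Θ (x 0) (x - c (x 0)))‖ := mul_le_mul_of_nonneg_left hsp hε0.le
  have hf₂O : f₂ x ∈ O := by
    change 0 < Kerr.radius (ε * a) (f₂ x)
    exact Kerr.radius_pos_of_abs_lt (by linarith)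
  have hxs : x ∈ s := hf₂O
  -- Faà di Bruno
  have hcomp := norm_iteratedFDerivWithin_comp_le (g := K) (f := f₂) (n := k)
    (N := ((m : ℕ∞) : WithTop ℕ∞)) (x := x) hKc hf₂c.contDiffOn (by exact_mod_cast hk)
    hOo.uniqueDiffOn hso.uniqueDiffOn (fun y hy ↦ hy) hxs (C := B) (D := D)
    (fun i hi ↦ by
      rw [iteratedFDerivWithin_of_isOpen i hOo hf₂O]
      exact hB i (hi.trans hk) (ε * a) (f₂ x) hεa hnf₂x hsp1)
    (fun i hi1 hik ↦ by
      rw [iteratedFDerivWithin_of_isOpen i hso hxs]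
      exact norm_iteratedFDeriv_scaled_restPosition_le hΘ hc hΘb hcb hΓ hε0 hε1 hεx hi1
        (hik.trans hk))
  have hmono : (k.factorial : ℝ) * B * D ^ k ≤ (m.factorial : ℝ) * B * D ^ m := by
    have h1 : (k.factorial : ℝ) ≤ m.factorial := by exact_mod_cast Nat.factorial_le hk
    have h2 : D ^ k ≤ D ^ m := pow_le_pow_right₀ hD1 hk
    exact mul_le_mul (mul_le_mul_of_nonneg_right h1 hB0) h2 (by positivity) (by positivity)
  -- the scaling identity `P = εM · K ∘ f₂`
  have hPform : (fun y ↦ Kerr.bilin M a (Θ (y 0) (y - c (y 0))) - Minkowski.bilin) =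
      fun y ↦ (ε * M) • (K ∘ f₂) y := by
    funext y
    exact Kerr.ksPert_smul hε0 M a _
  have hKf : ContDiffOn ℝ m (K ∘ f₂) s := hKc.comp hf₂c.contDiffOn fun y hy ↦ hy
  rw [← iteratedFDerivWithin_of_isOpen k hso hxs, hPform,
    norm_iteratedFDerivWithin_const_smul_eq (ε * M) ((hKf x hxs).of_le (by exact_mod_cast hk))
      hso.uniqueDiffOn hxs, abs_mul, abs_of_pos hε0]
  calc ε * |M| * ‖iteratedFDerivWithin ℝ k (K ∘ f₂) s x‖ ≤ ε * |M| * (k.factorial * B * D ^ k) :=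
        mul_le_mul_of_nonneg_left hcomp (by positivity)
    _ ≤ ε * |M| * (m.factorial * B * D ^ m) := mul_le_mul_of_nonneg_left hmono (by positivity)
    _ = |M| * (m.factorial * B * D ^ m) / d := by rw [hε, div_eq_mul_inv]; ring

-- operator-norm instance paths on form-valued multilinear maps are slow to unify
set_option synthInstance.maxHeartbeats 200000 in
/-- **Step 3 — attaching the frame to a form-valued map.** If `P : E4 → (forms)` is `Cᵐ` on an
open `s ∋ x` with `‖Dᵏ P(x)‖ ≤ α` (`k ≤ m`) and `‖Θ⁽ᵏ⁾(x⁰)‖ ≤ Γ` (`k ≤ m`), then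
`‖Dᵐ [y ↦ P(y)(Θ(y⁰)·, Θ(y⁰)·)](x)‖ ≤ 4ᵐ Γ² α` (two Leibniz bounds on the scalar evaluations
`y ↦ P(y)(Θ(y⁰)v)(Θ(y⁰)w)`, then `norm_iteratedFDeriv_le_of_forall_apply₂`). [folklore] -/
theorem norm_iteratedFDeriv_bilinearComp_frame_le {P : E4 → E4 →L[ℝ] E4 →L[ℝ] ℝ}
    {Θ : ℝ → E4 →L[ℝ] E4} {s : Set E4} {x : E4} {m : ℕ} {α Γ : ℝ} (hs : IsOpen s) (hx : x ∈ s)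
    (hP : ContDiffOn ℝ m P s) (hPb : ∀ k ≤ m, ‖iteratedFDeriv ℝ k P x‖ ≤ α) (hΘ : ContDiff ℝ m Θ)
    (hΘb : ∀ k ≤ m, ‖iteratedDeriv k Θ (x 0)‖ ≤ Γ) (hα : 0 ≤ α) (hΓ : 0 ≤ Γ) :
    ‖iteratedFDeriv ℝ m (fun y ↦ (P y).bilinearComp (Θ (y 0)) (Θ (y 0))) x‖ ≤
      2 ^ m * 2 ^ m * Γ ^ 2 * α := by
  have hproj : ContDiff ℝ m (fun y : E4 ↦ y 0) :=
    (EuclideanSpace.proj (0 : Fin 4) : E4 →L[ℝ] ℝ).contDiff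
  have hΘπc : ContDiff ℝ m (fun y : E4 ↦ Θ (y 0)) := hΘ.comp hproj
  have huc : ∀ u : E4, ContDiff ℝ m fun y : E4 ↦ Θ (y 0) u := fun u ↦
    hΘπc.clm_apply contDiff_const
  have hub : ∀ u : E4, ∀ i ≤ m, ‖iteratedFDeriv ℝ i (fun y : E4 ↦ Θ (y 0) u) x‖ ≤ ‖u‖ * Γ :=
    fun u i hi ↦ (norm_iteratedFDeriv_frame_apply_le hΘ u x (by exact_mod_cast hi)).trans
      (mul_le_mul_of_nonneg_left (hΘb i hi) (norm_nonneg u))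
  have hPb' : ∀ k ≤ m, ‖iteratedFDerivWithin ℝ k P s x‖ ≤ α := fun k hk ↦ by
    rw [iteratedFDerivWithin_of_isOpen k hs hx]
    exact hPb k hk
  have hscalar : ∀ v w : E4, ‖iteratedFDeriv ℝ m (fun y ↦ P y (Θ (y 0) v) (Θ (y 0) w)) x‖ ≤
      2 ^ m * 2 ^ m * Γ ^ 2 * α * ‖v‖ * ‖w‖ := by
    intro v w
    -- first evaluation
    have hWc : ContDiffOn ℝ m (fun y ↦ P y (Θ (y 0) v)) s := hP.clm_apply (huc v).contDiffOn
    have hWb : ∀ n ≤ m, ‖iteratedFDerivWithin ℝ n (fun y ↦ P y (Θ (y 0) v)) s x‖ ≤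
        2 ^ m * α * (‖v‖ * Γ) := by
      intro n hn
      have h1 := norm_iteratedFDerivWithin_clm_apply (f := P) (g := fun y : E4 ↦ Θ (y 0) v) hP
        (huc v).contDiffOn hs.uniqueDiffOn hx (n := n) (by exact_mod_cast hn)
      refine h1.trans ?_
      have h2 := sum_choose_mul_mul_le (n := n) (A := fun i ↦ ‖iteratedFDerivWithin ℝ i P s x‖)
        (B := fun i ↦ ‖iteratedFDerivWithin ℝ i (fun y : E4 ↦ Θ (y 0) v) s x‖) (α := α)
        (β := ‖v‖ * Γ) hα (fun i hi ↦ hPb' i (hi.trans hn)) (fun i ↦ norm_nonneg _)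
        (fun i hi ↦ by
          rw [iteratedFDerivWithin_of_isOpen i hs hx]
          exact hub v i (hi.trans hn))
      refine h2.trans ?_
      have h3 : (2 : ℝ) ^ n ≤ 2 ^ m := pow_le_pow_right₀ one_le_two hn
      gcongr
    -- second evaluation
    have h4 := norm_iteratedFDerivWithin_clm_apply (f := fun y ↦ P y (Θ (y 0) v))
      (g := fun y : E4 ↦ Θ (y 0) w) hWc (huc w).contDiffOn hs.uniqueDiffOn hx (n := m) le_rfl
    have h5 := sum_choose_mul_mul_le (n := m)
      (A := fun i ↦ ‖iteratedFDerivWithin ℝ i (fun y ↦ P y (Θ (y 0) v)) s x‖)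
      (B := fun i ↦ ‖iteratedFDerivWithin ℝ i (fun y : E4 ↦ Θ (y 0) w) s x‖)
      (α := 2 ^ m * α * (‖v‖ * Γ)) (β := ‖w‖ * Γ) (by positivity) (fun i hi ↦ hWb i hi)
      (fun i ↦ norm_nonneg _)
      (fun i hi ↦ by
        rw [iteratedFDerivWithin_of_isOpen i hs hx]
        exact hub w i hi)
    rw [← iteratedFDerivWithin_of_isOpen m hs hx]
    calc ‖iteratedFDerivWithin ℝ m (fun y ↦ P y (Θ (y 0) v) (Θ (y 0) w)) s x‖
        ≤ 2 ^ m * (2 ^ m * α * (‖v‖ * Γ)) * (‖w‖ * Γ) := h4.trans h5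
      _ = 2 ^ m * 2 ^ m * Γ ^ 2 * α * ‖v‖ * ‖w‖ := by ring
  have hFc : ContDiffAt ℝ m (fun y ↦ (P y).bilinearComp (Θ (y 0)) (Θ (y 0))) x :=
    (contDiffWithinAt_bilinearComp_self (hP x hx) hΘπc.contDiffAt.contDiffWithinAt).contDiffAt
      (hs.mem_nhds hx)
  exact norm_iteratedFDeriv_le_of_forall_apply₂ hFc (by positivity) fun v w ↦ hscalar v w

/-- **`Cᵐ` decay of the Kerr–Schild perturbation in a time-dependent frame about a moving centre.**
For every order `m` and size `Γ ≥ 1` there is `C ≥ 0` such that for all `M, a`, all `Cᵐ` frame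
paths `Θ : ℝ → (E4 →L E4)` and centre paths `c : ℝ → E4` with `‖Θ⁽ᵏ⁾(x⁰)‖ ≤ Γ` (`k ≤ m`) and
`‖c⁽ᵏ⁾(x⁰)‖ ≤ Γ` (`1 ≤ k ≤ m`), and every point `x` with `‖x − c(x⁰)‖ ≤ d`,
`d ≤ ‖(Θ(x⁰)(x − c(x⁰)))~‖` and `d ≥ max 1 (2|a|)`:
`‖Dᵐ [y ↦ (g_{M,a}(Θ(y⁰)(y − c(y⁰))) − η)(Θ(y⁰)·, Θ(y⁰)·)](x)‖ ≤ |M| C / d`.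
Kerr–Schild 1965, §2–§3 (homogeneity and asymptotic flatness of the Kerr–Schild form); the
modulated (time-dependent frame) version is this file's. [cite: KerrSchild1965, §3] -/
theorem exists_norm_iteratedFDeriv_ksPert_frame_le' (m : ℕ) {Γ : ℝ} (hΓ : 1 ≤ Γ) :
    ∃ C : ℝ, 0 ≤ C ∧ ∀ (M a : ℝ) (Θ : ℝ → E4 →L[ℝ] E4) (c : ℝ → E4) (x : E4) (d : ℝ),
      ContDiff ℝ m Θ → ContDiff ℝ m c →
      (∀ k ≤ m, ‖iteratedDeriv k Θ (x 0)‖ ≤ Γ) →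
      (∀ k, 1 ≤ k → k ≤ m → ‖iteratedDeriv k c (x 0)‖ ≤ Γ) →
      max 1 (2 * |a|) ≤ d → ‖x - c (x 0)‖ ≤ d →
      d ≤ E4.spatialNorm (Θ (x 0) (x - c (x 0))) →
      ‖iteratedFDeriv ℝ m (fun y ↦ (Kerr.bilin M a (Θ (y 0) (y - c (y 0))) -
        Minkowski.bilin).bilinearComp (Θ (y 0)) (Θ (y 0))) x‖ ≤ |M| * C / d := by
  obtain ⟨C₁, hC₁, hP⟩ := exists_norm_iteratedFDeriv_restFactor_le m hΓ
  have hΓ0 : 0 ≤ Γ := zero_le_one.trans hΓ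
  refine ⟨2 ^ m * 2 ^ m * Γ ^ 2 * C₁, by positivity, ?_⟩
  intro M a Θ c x d hΘ hc hΘb hcb hd hxd hsp
  have hd1 : 1 ≤ d := (le_max_left _ _).trans hd
  have hd0 : 0 < d := one_pos.trans_le hd1
  have hda : 2 * |a| ≤ d := (le_max_right _ _).trans hd
  -- the rest-frame factor is smooth on the open set where the rest position is off the ring
  set s : Set E4 := {y | 0 < Kerr.radius a (Θ (y 0) (y - c (y 0)))} with hs
  have hproj : ContDiff ℝ m (fun y : E4 ↦ y 0) :=
    (EuclideanSpace.proj (0 : Fin 4) : E4 →L[ℝ] ℝ).contDiff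
  have hφc : ContDiff ℝ m (fun y : E4 ↦ Θ (y 0) (y - c (y 0))) :=
    (hΘ.comp hproj).clm_apply (contDiff_id.sub (hc.comp hproj))
  have hso : IsOpen s := (isOpen_lt continuous_const (Kerr.continuous_radius a)).preimage
    hφc.continuous
  have hxs : x ∈ s := by
    change 0 < Kerr.radius a (Θ (x 0) (x - c (x 0)))
    refine Kerr.radius_pos_of_abs_lt ?_
    change |a| < ‖E4.spatial (Θ (x 0) (x - c (x 0)))‖
    have : |a| < d := by linarith [abs_nonneg a]
    exact this.trans_le hsp
  have hPc : ContDiffOn ℝ m (fun y ↦ Kerr.bilin M a (Θ (y 0) (y - c (y 0))) - Minkowski.bilin) s :=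
    fun y hy ↦ ((Kerr.contDiffAt_ksPert hy).comp y hφc.contDiffAt).contDiffWithinAt
  have hbound := norm_iteratedFDeriv_bilinearComp_frame_le hso hxs hPc
    (fun k hk ↦ hP M a Θ c x d hΘ hc hΘb hcb hd hxd hsp k hk) hΘ hΘb (by positivity) hΓ0
  calc _ ≤ 2 ^ m * 2 ^ m * Γ ^ 2 * (|M| * C₁ / d) := hbound
    _ = |M| * (2 ^ m * 2 ^ m * Γ ^ 2 * C₁) / d := by ring

-- operator-norm instance paths on form-valued multilinear maps are slow to unify
set_option synthInstance.maxHeartbeats 200000 in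
/-- Registered sub-goal form (stub `exists_norm_iteratedFDeriv_ksPert_frame_le` of the crux item)
of `exists_norm_iteratedFDeriv_ksPert_frame_le'`: `Cᵐ` decay `|M| C / d` of the Kerr–Schild
perturbation in a time-dependent frame about a moving centre. Kerr–Schild 1965, §2–§3.
[cite: KerrSchild1965, §3] -/
theorem exists_norm_iteratedFDeriv_ksPert_frame_le : open Literature.Geometry.Lorentzian in ∀ (m : ℕ) {Γ : ℝ}, 1 ≤ Γ → ∃ C : ℝ, 0 ≤ C ∧ ∀ (M a : ℝ) (Θ : ℝ → E4 →L[ℝ] E4) (c : ℝ → E4) (x : E4) (d : ℝ), ContDiff ℝ m Θ → ContDiff ℝ m c → (∀ k ≤ m, ‖iteratedDeriv k Θ (x 0)‖ ≤ Γ) → (∀ k, 1 ≤ k → k ≤ m → ‖iteratedDeriv k c (x 0)‖ ≤ Γ) → max 1 (2 * |a|) ≤ d → ‖x - c (x 0)‖ ≤ d → d ≤ E4.spatialNorm (Θ (x 0) (x - c (x 0))) → ‖iteratedFDeriv ℝ m (fun y ↦ (Kerr.bilin M a (Θ (y 0) (y - c (y 0))) - Minkowski.bilin).bilinearComp (Θ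 (y 0)) (Θ (y 0))) x‖ ≤ |M| * C / d :=
  exists_norm_iteratedFDeriv_ksPert_frame_le'

end Summit.FinalStateConjecture.FinalStateConjecture.Theorems

end
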